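import Summits.AtomisticToContinuum.HydrodynamicLimit.Theorems.TwoClocksEquilibriumShearWindowLD
import Literature.MathematicalPhysics.KineticTheory.HardSphereEulerProofs

/-!
# Stub `stub_dualFamily` of the line `Sketch` (doubling RG) for the crux
`TwoClocks.EquilibriumFastWindowLD` (stmt-AtomisticToContinuum-14440)

NF-a1, a BOUNDED DUAL FAMILY to the collision invariants. For `θ > 0` and `u ∈ ℝ³` we
construct continuous, compactly supported `ψ₀, ψ₂ : ℝ³ → ℝ` and `ψ₁ : Fin 3 → ℝ³ → ℝ` which are
dual, under the Maxwellian weight `M = M_{1,u,θ}`, to the centred collision invariants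
`1, v_j - u_j, |v - u|²`:
`⟨ψ₀, 1⟩ = 1`, `⟨ψ₁ⱼ, v_l - u_l⟩ = δ_{jl}`, `⟨ψ₂, |v - u|²⟩ = 1`, every other pairing `0`.

Construction. Two radial tents in the speed `r = |v - u|` on disjoint shells,
`b₁(r) = max 0 (1 - |2r - 3|)` (shell `1 ≤ r ≤ 2`, so `b₁ r² ≤ 4 b₁`) and
`b₂(r) = max 0 (1 - |2r - 7|)` (shell `3 ≤ r ≤ 4`, so `9 b₂ ≤ b₂ r²`). With the moments
`mᵢ = ∫ bᵢ M > 0`, `sᵢ = ∫ bᵢ r² M` one has `s₁ ≤ 4 m₁`, `9 m₂ ≤ s₂`, hence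
`d = m₁ s₂ - s₁ m₂ ≥ 5 m₁ m₂ > 0`, and `ψ₀ = (s₂ b₁ - s₁ b₂)/d`, `ψ₂ = (m₁ b₂ - m₂ b₁)/d` solve
the radial `2 × 2` system; `ψ₁ⱼ = κⱼ⁻¹ (v_j - u_j) b₁`, `κⱼ = ∫ (v_j - u_j)² b₁ M > 0`, gives the
diagonal pairing. Every remaining pairing vanishes by ODDNESS under the reflection of one
velocity coordinate about `u`: translate by `u` (Lebesgue measure is translation invariant) and
use the landed reflection tools `exists_velFlip`, `integral_eq_zero_of_odd_linearIsometryEquiv`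
of `Theorems/TwoClocksEquilibriumShearWindowLD.lean`. No Gaussian moment is computed.
-/

noncomputable section

open MeasureTheory ProbabilityTheory Real Set Filter
open scoped ENNReal BigOperators

namespace Summit.AtomisticToContinuum.HydrodynamicLimit.Theorems.FastWindowRG

open Literature.Analysis.FluidPDE Literature.MathematicalPhysics.KineticTheory

/-! ### Odd Maxwellian moments about `u` vanish -/

/-- If `f (u + R w) = -f (u + w)` for a linear isometry `R` of `ℝ³` then `∫ f = 0`: translate by
`u` (`integral_add_left_eq_self`), then `integral_eq_zero_of_odd_linearIsometryEquiv`. No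
integrability is needed. [folklore] -/
private theorem integral_eq_zero_of_odd_shift (u : V3) {f : V3 → ℝ} (R : V3 ≃ₗᵢ[ℝ] V3)
    (hf : ∀ w, f (u + R w) = -f (u + w)) : ∫ v, f v = 0 := by
  rw [← integral_add_left_eq_self f u]
  exact integral_eq_zero_of_odd_linearIsometryEquiv R hf

/-- The Maxwellian centred at `u` is even about `u` under every linear isometry `R`:
`M_{1,u,θ}(u + R w) = M_{1,u,θ}(u + w)`. [folklore] -/
private theorem localMaxwellian_shift_isometry (θ : ℝ) (u : V3) (R : V3 ≃ₗᵢ[ℝ] V3) (w : V3) :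
    localMaxwellian 1 θ u (u + R w) = localMaxwellian 1 θ u (u + w) := by
  simp only [localMaxwellian, add_sub_cancel_left, LinearIsometryEquiv.norm_map]

/-- A radial (in `|v - u|`) weight against one centred coordinate has zero Maxwellian moment
(odd under the reflection of that coordinate about `u`). [folklore] -/
private theorem integral_radial_mul_coord (b : ℝ → ℝ) (θ : ℝ) (u : V3) (j : Fin 3) :
    ∫ v, b ‖v - u‖ * (v j - u j) * localMaxwellian 1 θ u v = 0 := by
  obtain ⟨R, hR⟩ := exists_velFlip j
  refine integral_eq_zero_of_odd_shift u R fun w => ?_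
  rw [localMaxwellian_shift_isometry]
  simp only [PiLp.add_apply, add_sub_cancel_left, LinearIsometryEquiv.norm_map]
  rw [hR w j, if_pos rfl]
  ring

/-- `c (v_j - u_j) b(|v - u|)` has zero Maxwellian moment (odd in the `j`-th coordinate).
[folklore] -/
private theorem integral_coordTent (c : ℝ) (b : ℝ → ℝ) (θ : ℝ) (u : V3) (j : Fin 3) :
    ∫ v, c * ((v j - u j) * b ‖v - u‖) * localMaxwellian 1 θ u v = 0 := by
  obtain ⟨R, hR⟩ := exists_velFlip j
  refine integral_eq_zero_of_odd_shift u R fun w => ?_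
  rw [localMaxwellian_shift_isometry]
  simp only [PiLp.add_apply, add_sub_cancel_left, LinearIsometryEquiv.norm_map]
  rw [hR w j, if_pos rfl]
  ring

/-- `c (v_j - u_j) b(|v - u|)` is orthogonal to `v_l - u_l` for `l ≠ j` (odd in the `j`-th
coordinate, `v_l - u_l` being even under that reflection). [folklore] -/
private theorem integral_coordTent_mul_coord (c : ℝ) (b : ℝ → ℝ) (θ : ℝ) (u : V3) {j l : Fin 3}
    (hjl : j ≠ l) :
    ∫ v, c * ((v j - u j) * b ‖v - u‖) * (v l - u l) * localMaxwellian 1 θ u v = 0 := by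
  obtain ⟨R, hR⟩ := exists_velFlip j
  refine integral_eq_zero_of_odd_shift u R fun w => ?_
  rw [localMaxwellian_shift_isometry]
  simp only [PiLp.add_apply, add_sub_cancel_left, LinearIsometryEquiv.norm_map]
  rw [hR w j, if_pos rfl, hR w l, if_neg (Ne.symm hjl)]
  ring

/-- `c (v_j - u_j) b(|v - u|)` is orthogonal to `|v - u|²` (odd in the `j`-th coordinate, the
speed being even). [folklore] -/
private theorem integral_coordTent_mul_normSq (c : ℝ) (b : ℝ → ℝ) (θ : ℝ) (u : V3) (j : Fin 3) :
    ∫ v, c * ((v j - u j) * b ‖v - u‖) * ‖v - u‖ ^ 2 * localMaxwellian 1 θ u v = 0 := by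
  obtain ⟨R, hR⟩ := exists_velFlip j
  refine integral_eq_zero_of_odd_shift u R fun w => ?_
  rw [localMaxwellian_shift_isometry]
  simp only [PiLp.add_apply, add_sub_cancel_left, LinearIsometryEquiv.norm_map]
  rw [hR w j, if_pos rfl]
  ring

/-! ### Linear bookkeeping of the radial moments -/

/-- Pulling a constant out of a triple product under the integral. [folklore] -/
private theorem integral_const_mul₃ (c : ℝ) (X Y Z : V3 → ℝ) :
    ∫ v, c * X v * Y v * Z v = c * ∫ v, X v * Y v * Z v := by
  rw [← integral_const_mul]
  refine integral_congr_ae (ae_of_all _ fun v => ?_)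
  show c * X v * Y v * Z v = c * (X v * Y v * Z v)
  ring

/-- Linearity: `∫ (a f - b g)/d · w = (a ∫ f w - b ∫ g w)/d` for integrable `f w`, `g w`.
[folklore] -/
private theorem integral_lincomb_mul (a b d : ℝ) {f g w : V3 → ℝ}
    (hf : Integrable fun v => f v * w v) (hg : Integrable fun v => g v * w v) :
    ∫ v, (a * f v - b * g v) / d * w v =
      (a * (∫ v, f v * w v) - b * (∫ v, g v * w v)) / d := by
  have h : ∀ v, (a * f v - b * g v) / d * w v = (a * (f v * w v) - b * (g v * w v)) / d :=
    fun v => by ring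
  simp_rw [h]
  rw [integral_div, integral_sub (hf.const_mul a) (hg.const_mul b), integral_const_mul,
    integral_const_mul]

/-- A continuous function on `ℝ³` vanishing outside the ball of radius `4` about `u` is
integrable (continuous with compact support). [folklore] -/
private theorem integrable_of_vanishing (u : V3) {f : V3 → ℝ} (hf : Continuous f)
    (hfz : ∀ v, 4 < ‖v - u‖ → f v = 0) : Integrable f := by
  refine hf.integrable_of_hasCompactSupport ?_
  refine HasCompactSupport.intro (isCompact_closedBall u 4) fun v hv => hfz v ?_
  rwa [Metric.mem_closedBall, dist_eq_norm, not_le] at hv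

/-! ### The two tents -/

/-- The inner tent vanishes from speed `4` on. [folklore] -/
private theorem tent₃_eq_zero (r : ℝ) (hr : 4 ≤ r) : max 0 (1 - |2 * r - 3|) = 0 :=
  max_eq_left (by rw [abs_of_nonneg (by linarith)]; linarith)

/-- The outer tent vanishes from speed `4` on. [folklore] -/
private theorem tent₇_eq_zero (r : ℝ) (hr : 4 ≤ r) : max 0 (1 - |2 * r - 7|) = 0 :=
  max_eq_left (by rw [abs_of_nonneg (by linarith)]; linarith)

/-- On the inner tent `r² ≤ 4`. [folklore] -/
private theorem tent₃_mul_sq_le (r : ℝ) (hr : 0 ≤ r) :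
    max 0 (1 - |2 * r - 3|) * r ^ 2 ≤ 4 * max 0 (1 - |2 * r - 3|) := by
  rcases le_or_gt r 2 with h | h
  · have h4 : r ^ 2 ≤ 4 := by nlinarith
    have h0 : 0 ≤ max 0 (1 - |2 * r - 3|) := le_max_left _ _
    nlinarith
  · rw [max_eq_left (by rw [abs_of_nonneg (by linarith)]; linarith)]
    simp

/-- On the outer tent `9 ≤ r²`. [folklore] -/
private theorem tent₇_sq_mul_ge (r : ℝ) :
    9 * max 0 (1 - |2 * r - 7|) ≤ max 0 (1 - |2 * r - 7|) * r ^ 2 := by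
  rcases lt_or_ge r 3 with h | h
  · rw [max_eq_left (by rw [abs_of_neg (by linarith)]; linarith)]
    simp
  · have h9 : 9 ≤ r ^ 2 := by nlinarith
    have h0 : 0 ≤ max 0 (1 - |2 * r - 7|) := le_max_left _ _
    nlinarith

/-- The inner tent is `1` at speed `3/2`. [folklore] -/
private theorem tent₃_val : max 0 (1 - |2 * (3 / 2 : ℝ) - 3|) = 1 := by
  rw [show (2 : ℝ) * (3 / 2) - 3 = 0 by norm_num, abs_zero, sub_zero, max_eq_right zero_le_one]

/-- The outer tent is `1` at speed `7/2`. [folklore] -/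
private theorem tent₇_val : max 0 (1 - |2 * (7 / 2 : ℝ) - 7|) = 1 := by
  rw [show (2 : ℝ) * (7 / 2) - 7 = 0 by norm_num, abs_zero, sub_zero, max_eq_right zero_le_one]

/-! ### Assembly from two abstract tents -/

/-- **Assembly.** Two continuous nonnegative radial profiles `b₁, b₂` vanishing from speed `4`
on, with `b₁ r² ≤ 4 b₁`, `9 b₂ ≤ b₂ r²`, `b₁(3/2) ≠ 0`, `b₂(7/2) ≠ 0`, yield the dual family:
`ψ₀ = (s₂ b₁ - s₁ b₂)/d`, `ψ₂ = (m₁ b₂ - m₂ b₁)/d`, `ψ₁ⱼ = κⱼ⁻¹ (v_j - u_j) b₁` with the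
moments `mᵢ = ∫ bᵢ M`, `sᵢ = ∫ bᵢ r² M`, `κⱼ = ∫ (v_j - u_j)² b₁ M` and
`d = m₁ s₂ - s₁ m₂ ≥ 5 m₁ m₂ > 0`. [folklore] -/
private theorem dualFamily_of_tents {θ : ℝ} (hθ : 0 < θ) (u : V3) {b₁ b₂ : ℝ → ℝ}
    (hb₁c : Continuous b₁) (hb₂c : Continuous b₂)
    (hb₁z : ∀ r, 4 ≤ r → b₁ r = 0) (hb₂z : ∀ r, 4 ≤ r → b₂ r = 0)
    (hb₁n : ∀ r, 0 ≤ b₁ r) (hb₂n : ∀ r, 0 ≤ b₂ r)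
    (hb₁le : ∀ r, 0 ≤ r → b₁ r * r ^ 2 ≤ 4 * b₁ r) (hb₂ge : ∀ r, 9 * b₂ r ≤ b₂ r * r ^ 2)
    (hb₁v : b₁ (3 / 2) ≠ 0) (hb₂v : b₂ (7 / 2) ≠ 0) :
    ∃ ψ₀ ψ₂ : V3 → ℝ, ∃ ψ₁ : Fin 3 → V3 → ℝ,
      Continuous ψ₀ ∧ Continuous ψ₂ ∧ (∀ j, Continuous (ψ₁ j)) ∧
      (∃ R : ℝ, ∀ v : V3, R ≤ ‖v‖ → ψ₀ v = 0 ∧ ψ₂ v = 0 ∧ ∀ j, ψ₁ j v = 0) ∧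
      (∫ v, ψ₀ v * localMaxwellian 1 θ u v = 1) ∧
      (∀ j : Fin 3, ∫ v, ψ₀ v * (v j - u j) * localMaxwellian 1 θ u v = 0) ∧
      (∫ v, ψ₀ v * ‖v - u‖ ^ 2 * localMaxwellian 1 θ u v = 0) ∧
      (∀ j : Fin 3, ∫ v, ψ₁ j v * localMaxwellian 1 θ u v = 0) ∧
      (∀ j l : Fin 3, ∫ v, ψ₁ j v * (v l - u l) * localMaxwellian 1 θ u v =
        if j = l then 1 else 0) ∧
      (∀ j : Fin 3, ∫ v, ψ₁ j v * ‖v - u‖ ^ 2 * localMaxwellian 1 θ u v = 0) ∧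
      (∫ v, ψ₂ v * localMaxwellian 1 θ u v = 0) ∧
      (∀ j : Fin 3, ∫ v, ψ₂ v * (v j - u j) * localMaxwellian 1 θ u v = 0) ∧
      (∫ v, ψ₂ v * ‖v - u‖ ^ 2 * localMaxwellian 1 θ u v = 1) := by
  -- the Maxwellian weight
  have hMc : Continuous (localMaxwellian 1 θ u) := continuous_localMaxwellian 1 θ u
  have hM0 : ∀ v, 0 ≤ localMaxwellian 1 θ u v := fun v =>
    localMaxwellian_nonneg zero_le_one hθ.le u v
  have hMp : ∀ v, 0 < localMaxwellian 1 θ u v := fun v => localMaxwellian_pos one_pos hθ u v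
  -- integrability of the tent moments (continuous, supported in the ball of radius `4`)
  have hI₁ : Integrable fun v => b₁ ‖v - u‖ * localMaxwellian 1 θ u v :=
    integrable_of_vanishing u (by fun_prop) fun v hv => by simp [hb₁z _ hv.le]
  have hI₂ : Integrable fun v => b₂ ‖v - u‖ * localMaxwellian 1 θ u v :=
    integrable_of_vanishing u (by fun_prop) fun v hv => by simp [hb₂z _ hv.le]
  have hJ₁ : Integrable fun v => b₁ ‖v - u‖ * (‖v - u‖ ^ 2 * localMaxwellian 1 θ u v) :=
    integrable_of_vanishing u (by fun_prop) fun v hv => by simp [hb₁z _ hv.le]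
  have hJ₂ : Integrable fun v => b₂ ‖v - u‖ * (‖v - u‖ ^ 2 * localMaxwellian 1 θ u v) :=
    integrable_of_vanishing u (by fun_prop) fun v hv => by simp [hb₂z _ hv.le]
  have hK : ∀ j : Fin 3, Integrable fun v =>
      (v j - u j) * b₁ ‖v - u‖ * (v j - u j) * localMaxwellian 1 θ u v := fun j =>
    integrable_of_vanishing u (by fun_prop) fun v hv => by simp [hb₁z _ hv.le]
  -- the moments, as opaque constants
  obtain ⟨m₁, hm₁⟩ : ∃ m : ℝ, ∫ v, b₁ ‖v - u‖ * localMaxwellian 1 θ u v = m := ⟨_, rfl⟩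
  obtain ⟨m₂, hm₂⟩ : ∃ m : ℝ, ∫ v, b₂ ‖v - u‖ * localMaxwellian 1 θ u v = m := ⟨_, rfl⟩
  obtain ⟨s₁, hs₁⟩ : ∃ s : ℝ,
      ∫ v, b₁ ‖v - u‖ * (‖v - u‖ ^ 2 * localMaxwellian 1 θ u v) = s := ⟨_, rfl⟩
  obtain ⟨s₂, hs₂⟩ : ∃ s : ℝ,
      ∫ v, b₂ ‖v - u‖ * (‖v - u‖ ^ 2 * localMaxwellian 1 θ u v) = s := ⟨_, rfl⟩
  obtain ⟨κ, hκ⟩ : ∃ κ : Fin 3 → ℝ, ∀ j,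
      ∫ v, (v j - u j) * b₁ ‖v - u‖ * (v j - u j) * localMaxwellian 1 θ u v = κ j :=
    ⟨fun j => ∫ v, (v j - u j) * b₁ ‖v - u‖ * (v j - u j) * localMaxwellian 1 θ u v,
      fun j => rfl⟩
  -- a point at speed `a` from `u` along the `j`-th axis
  have hpt : ∀ (j : Fin 3) (a : ℝ), 0 < a →
      ‖u + EuclideanSpace.single j a - u‖ = a ∧ (u + EuclideanSpace.single j a) j - u j = a := by
    intro j a ha
    refine ⟨?_, ?_⟩
    · rw [add_sub_cancel_left, PiLp.norm_single, Real.norm_eq_abs, abs_of_pos ha]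
    · rw [PiLp.add_apply, add_sub_cancel_left, PiLp.single_apply, if_pos rfl]
  -- positivity of the moments
  have hm₁p : 0 < m₁ := by
    rw [← hm₁]
    refine integral_pos_of_integrable_nonneg_nonzero
      (x := u + EuclideanSpace.single (0 : Fin 3) (3 / 2 : ℝ)) (by fun_prop) hI₁
      (fun v => mul_nonneg (hb₁n _) (hM0 v)) ?_
    rw [(hpt 0 (3 / 2) (by norm_num)).1]
    exact mul_ne_zero hb₁v (hMp _).ne'
  have hm₂p : 0 < m₂ := by
    rw [← hm₂]
    refine integral_pos_of_integrable_nonneg_nonzero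
      (x := u + EuclideanSpace.single (0 : Fin 3) (7 / 2 : ℝ)) (by fun_prop) hI₂
      (fun v => mul_nonneg (hb₂n _) (hM0 v)) ?_
    rw [(hpt 0 (7 / 2) (by norm_num)).1]
    exact mul_ne_zero hb₂v (hMp _).ne'
  have hκp : ∀ j, 0 < κ j := by
    intro j
    rw [← hκ j]
    refine integral_pos_of_integrable_nonneg_nonzero
      (x := u + EuclideanSpace.single j (3 / 2 : ℝ)) (by fun_prop) (hK j) (fun v => ?_) ?_
    · show 0 ≤ (v j - u j) * b₁ ‖v - u‖ * (v j - u j) * localMaxwellian 1 θ u v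
      have h := mul_nonneg (mul_self_nonneg (v j - u j)) (mul_nonneg (hb₁n ‖v - u‖) (hM0 v))
      linarith [h]
    · rw [(hpt j (3 / 2) (by norm_num)).1, (hpt j (3 / 2) (by norm_num)).2]
      exact mul_ne_zero (mul_ne_zero (mul_ne_zero (by norm_num) hb₁v) (by norm_num)) (hMp _).ne'
  -- the determinant of the radial `2 × 2` system
  have hs₁le : s₁ ≤ 4 * m₁ := by
    rw [← hs₁, ← hm₁, ← integral_const_mul]
    refine integral_mono hJ₁ (hI₁.const_mul 4) fun v => ?_
    show b₁ ‖v - u‖ * (‖v - u‖ ^ 2 * localMaxwellian 1 θ u v) ≤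
      4 * (b₁ ‖v - u‖ * localMaxwellian 1 θ u v)
    have h := mul_le_mul_of_nonneg_right (hb₁le ‖v - u‖ (norm_nonneg _)) (hM0 v)
    linarith [h]
  have hs₂ge : 9 * m₂ ≤ s₂ := by
    rw [← hs₂, ← hm₂, ← integral_const_mul]
    refine integral_mono (hI₂.const_mul 9) hJ₂ fun v => ?_
    show 9 * (b₂ ‖v - u‖ * localMaxwellian 1 θ u v) ≤
      b₂ ‖v - u‖ * (‖v - u‖ ^ 2 * localMaxwellian 1 θ u v)
    have h := mul_le_mul_of_nonneg_right (hb₂ge ‖v - u‖) (hM0 v)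
    linarith [h]
  obtain ⟨d, hd⟩ : ∃ d : ℝ, m₁ * s₂ - s₁ * m₂ = d := ⟨_, rfl⟩
  have hdp : 0 < d := by
    rw [← hd]
    nlinarith [mul_le_mul_of_nonneg_left hs₂ge hm₁p.le, mul_le_mul_of_nonneg_right hs₁le hm₂p.le,
      mul_pos hm₁p hm₂p]
  -- the family
  obtain ⟨ψ₀, hψ₀⟩ : ∃ ψ : V3 → ℝ, ∀ v, ψ v = (s₂ * b₁ ‖v - u‖ - s₁ * b₂ ‖v - u‖) / d :=
    ⟨fun v => (s₂ * b₁ ‖v - u‖ - s₁ * b₂ ‖v - u‖) / d, fun v => rfl⟩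
  obtain ⟨ψ₂, hψ₂⟩ : ∃ ψ : V3 → ℝ, ∀ v, ψ v = (m₁ * b₂ ‖v - u‖ - m₂ * b₁ ‖v - u‖) / d :=
    ⟨fun v => (m₁ * b₂ ‖v - u‖ - m₂ * b₁ ‖v - u‖) / d, fun v => rfl⟩
  obtain ⟨ψ₁, hψ₁⟩ : ∃ ψ : Fin 3 → V3 → ℝ, ∀ j v,
      ψ j v = (κ j)⁻¹ * ((v j - u j) * b₁ ‖v - u‖) :=
    ⟨fun j v => (κ j)⁻¹ * ((v j - u j) * b₁ ‖v - u‖), fun j v => rfl⟩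
  refine ⟨ψ₀, ψ₂, ψ₁, ?_, ?_, ?_, ?_, ?_, ?_, ?_, ?_, ?_, ?_, ?_, ?_, ?_⟩
  · -- continuity of `ψ₀`
    rw [show ψ₀ = fun v => (s₂ * b₁ ‖v - u‖ - s₁ * b₂ ‖v - u‖) / d from funext hψ₀]
    fun_prop
  · -- continuity of `ψ₂`
    rw [show ψ₂ = fun v => (m₁ * b₂ ‖v - u‖ - m₂ * b₁ ‖v - u‖) / d from funext hψ₂]
    fun_prop
  · -- continuity of `ψ₁ j`
    intro j
    rw [show ψ₁ j = fun v => (κ j)⁻¹ * ((v j - u j) * b₁ ‖v - u‖) from funext (hψ₁ j)]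
    fun_prop
  · -- common compact support: everything vanishes for `|v| ≥ |u| + 4`
    refine ⟨‖u‖ + 4, fun v hv => ?_⟩
    have h4 : 4 ≤ ‖v - u‖ := by linarith [norm_sub_norm_le v u]
    simp [hψ₀, hψ₂, hψ₁, hb₁z _ h4, hb₂z _ h4]
  · -- `⟨ψ₀, 1⟩ = 1`
    simp_rw [hψ₀]
    rw [integral_lincomb_mul s₂ s₁ d hI₁ hI₂, hm₁, hm₂, div_eq_one_iff_eq hdp.ne', ← hd]
    ring
  · -- `⟨ψ₀, v_j - u_j⟩ = 0` (odd)
    intro j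
    simp_rw [hψ₀]
    exact integral_radial_mul_coord (fun r => (s₂ * b₁ r - s₁ * b₂ r) / d) θ u j
  · -- `⟨ψ₀, |v - u|²⟩ = 0`
    simp_rw [hψ₀, mul_assoc]
    rw [integral_lincomb_mul s₂ s₁ d hJ₁ hJ₂, hs₁, hs₂, mul_comm, sub_self, zero_div]
  · -- `⟨ψ₁ⱼ, 1⟩ = 0` (odd)
    intro j
    simp_rw [hψ₁]
    exact integral_coordTent (κ j)⁻¹ b₁ θ u j
  · -- `⟨ψ₁ⱼ, v_l - u_l⟩ = δ_{jl}`
    intro j l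
    simp_rw [hψ₁]
    split_ifs with hjl
    · subst hjl
      rw [integral_const_mul₃, hκ j]
      exact inv_mul_cancel₀ (hκp j).ne'
    · exact integral_coordTent_mul_coord (κ j)⁻¹ b₁ θ u hjl
  · -- `⟨ψ₁ⱼ, |v - u|²⟩ = 0` (odd)
    intro j
    simp_rw [hψ₁]
    exact integral_coordTent_mul_normSq (κ j)⁻¹ b₁ θ u j
  · -- `⟨ψ₂, 1⟩ = 0`
    simp_rw [hψ₂]
    rw [integral_lincomb_mul m₁ m₂ d hI₂ hI₁, hm₂, hm₁, mul_comm, sub_self, zero_div]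
  · -- `⟨ψ₂, v_j - u_j⟩ = 0` (odd)
    intro j
    simp_rw [hψ₂]
    exact integral_radial_mul_coord (fun r => (m₁ * b₂ r - m₂ * b₁ r) / d) θ u j
  · -- `⟨ψ₂, |v - u|²⟩ = 1`
    simp_rw [hψ₂, mul_assoc]
    rw [integral_lincomb_mul m₁ m₂ d hJ₂ hJ₁, hs₂, hs₁, div_eq_one_iff_eq hdp.ne', ← hd]
    ring

/-! ### The stub -/

/-- **NF-a1 `stub_dualFamily`** (statics). For `θ > 0`, `u ∈ ℝ³` there are continuous,
compactly supported `ψ₀, ψ₂ : ℝ³ → ℝ` and `ψ₁ : Fin 3 → ℝ³ → ℝ` dual, under the Maxwellian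
weight `M_{1,u,θ}`, to the centred collision invariants `1`, `v_j − u_j`, `|v − u|²` (radial
two-shell construction around `u` with the tents `max 0 (1 - |2|v-u| - 3|)`,
`max 0 (1 - |2|v-u| - 7|)`, plus the odd functions `(v_j − u_j) · tent`; all the off-pairings
vanish by reflection of one velocity coordinate about `u`). [folklore] -/
theorem stub_dualFamily {θ : ℝ} (hθ : 0 < θ) (u : V3) :
    ∃ ψ₀ ψ₂ : V3 → ℝ, ∃ ψ₁ : Fin 3 → V3 → ℝ,
      Continuous ψ₀ ∧ Continuous ψ₂ ∧ (∀ j, Continuous (ψ₁ j)) ∧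
      (∃ R : ℝ, ∀ v : V3, R ≤ ‖v‖ → ψ₀ v = 0 ∧ ψ₂ v = 0 ∧ ∀ j, ψ₁ j v = 0) ∧
      (∫ v, ψ₀ v * localMaxwellian 1 θ u v = 1) ∧
      (∀ j : Fin 3, ∫ v, ψ₀ v * (v j - u j) * localMaxwellian 1 θ u v = 0) ∧
      (∫ v, ψ₀ v * ‖v - u‖ ^ 2 * localMaxwellian 1 θ u v = 0) ∧
      (∀ j : Fin 3, ∫ v, ψ₁ j v * localMaxwellian 1 θ u v = 0) ∧
      (∀ j l : Fin 3, ∫ v, ψ₁ j v * (v l - u l) * localMaxwellian 1 θ u v = if j = l then 1 else 0) ∧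
      (∀ j : Fin 3, ∫ v, ψ₁ j v * ‖v - u‖ ^ 2 * localMaxwellian 1 θ u v = 0) ∧
      (∫ v, ψ₂ v * localMaxwellian 1 θ u v = 0) ∧
      (∀ j : Fin 3, ∫ v, ψ₂ v * (v j - u j) * localMaxwellian 1 θ u v = 0) ∧
      (∫ v, ψ₂ v * ‖v - u‖ ^ 2 * localMaxwellian 1 θ u v = 1) := by
  exact dualFamily_of_tents hθ u (b₁ := fun r => max 0 (1 - |2 * r - 3|))
    (b₂ := fun r => max 0 (1 - |2 * r - 7|)) (by fun_prop) (by fun_prop) tent₃_eq_zero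
    tent₇_eq_zero (fun r => le_max_left _ _) (fun r => le_max_left _ _) tent₃_mul_sq_le
    tent₇_sq_mul_ge (tent₃_val.trans_ne one_ne_zero) (tent₇_val.trans_ne one_ne_zero)

end Summit.AtomisticToContinuum.HydrodynamicLimit.Theorems.FastWindowRG
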